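import Summits.CriticalPhenomena.PercolationContinuityZ3.Theorems.PercNearOneGluingNoHeavyQuantIndepBlobFar
import HarnessLib

/-!
# QUANT lane R8, FAR on block-combs with TWO HEIGHTS (II): the TOP-HEAVY regime, any gates —
# `far_indepBlob` fibrewise at the bottom and once more at the top

builds on p205010 (kernel theorem, internal audit signed; external expert review pending)

Support file (`--supports stmt-CriticalPhenomena-4575`), QUANT lane lead (gen 11), rung R8 of `run/shared/lean/prim/quant/LADDER.md`;
paper `run/shared/lean/prim/quant/prim-quant-lead-g11/LEAD-NOTES-G11.md` N22 (3‴)(b).  Companion of `…QuantTwoHeightFar.lean` (same seat: the regimes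
'room at the bottom' and 'room at the top', gates `≥ 1/2`, via p1 g7's gap row).  Theorems only (Finset-weight vocabulary of `…QuantIndepBlobFar.lean`);
no definitions, no sorries, standard axioms.

**Setting** (as in `…QuantTwoHeightFar.lean`): upper blobs `i : ι` (sizes `a i ≥ 0`, gates `g ≤ p i ≤ 1`) at chain weight `w₁`, lower blobs `k : κ` (sizes
`b k ≥ 0`, gates `u ≤ q k ≤ 1`) at `w₂`, terminal block `c` at `x ≤ u·w₂`, `x ≤ g·w₁`; integer data read as reals with light = `a + b + c ≤ t`, heavy =
`t < a + b`.  Here NO gate needs to be `≥ 1/2`: instead the UPPER height together with the HALF-discounted lower height must carry the mean,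
`2t < g·(u(c + Σ b)/2 + Σ a)` ('top-heavy').  Then the fibres of upper mass `s > m := t − u(c + Σb)/2` have the lower height's own mean for their residual
level and are paid by `IndepBlob.far_indepBlob` at the bottom (credit `w₂ − x`); the bad fibres `s ≤ m` cost at most `P(X ≤ m)`, which `far_indepBlob` for the
upper height ALONE (terminal `t − m`) moves onto the crossings inside the upper height (credit `w₁ − x`).
* `Quant.IndepBlob.far_row` — `far_indepBlob` in two-event form `p₀·P(X + a₀ ≤ t) ≤ (1 − p₀)·P(t < X)`.
* `Quant.IndepBlob.twoHeight_fibre_far` — one fibre.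
* `Quant.IndepBlob.twoHeight_exchange_of_bottomHeavy` — the easy end: `2t < u·(c + Σ b)` (the lower height alone has the mean), any upper height.
* `Quant.IndepBlob.twoHeight_exchange_of_topHeavy` — the exchange inequality
  `x·Σ_U w(U)Σ_{a(U)+b(V)+c ≤ t} w(V) ≤ (w₁ − w₂)·Σ_{t < a(U)} w(U) + (w₂ − x)·Σ_U w(U)Σ_{t < a(U)+b(V)} w(V)` in the top-heavy regime.
[this work]; `far_indepBlob` is lead g5's.
-/

namespace Summit.CriticalPhenomena.PercolationContinuityZ3.Theorems

namespace Quant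

namespace IndepBlob

open Finset

variable {ι : Type*} [Fintype ι] [DecidableEq ι] {κ : Type*} [Fintype κ] [DecidableEq κ]

/-! ### The top-heavy regime (any gates): `far_indepBlob` fibrewise at the bottom and once more at the top -/

/-- The far-relay row of `IndepBlob.far_indepBlob` in two-event form: `p₀ · P(X + a₀ ≤ t) ≤ (1 − p₀) · P(t < X)`. [this work] -/
theorem far_row (p a : κ → ℝ) (p₀ a₀ : ℝ) (hp₀ : 0 ≤ p₀) (hp₀1 : p₀ ≤ 1) (hp : ∀ i, p₀ ≤ p i) (hp1 : ∀ i, p i ≤ 1)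
    (ha : ∀ i, 0 ≤ a i) (ha₀ : 0 ≤ a₀) (t : ℝ) (ht : 2 * t < a₀ * p₀ + ∑ i, a i * p i) :
    p₀ * (∑ W ∈ (Finset.univ : Finset (Finset κ)).filter (fun W => ∑ i ∈ W, a i + a₀ ≤ t),
        (∏ k, if k ∈ W then p k else 1 - p k)) ≤
      (1 - p₀) * (∑ W ∈ (Finset.univ : Finset (Finset κ)).filter (fun W => t < ∑ i ∈ W, a i),
        (∏ k, if k ∈ W then p k else 1 - p k)) := by
  have h := far_indepBlob p a p₀ a₀ hp₀ hp₀1 hp hp1 ha ha₀ t ht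
  have hsplit : (∑ W ∈ (Finset.univ : Finset (Finset κ)).filter (fun W => ∑ i ∈ W, a i ≤ t),
        (∏ k, if k ∈ W then p k else 1 - p k)) +
      (∑ W ∈ (Finset.univ : Finset (Finset κ)).filter (fun W => ¬ (∑ i ∈ W, a i ≤ t)),
        (∏ k, if k ∈ W then p k else 1 - p k)) = 1 := by
    rw [Finset.sum_filter_add_sum_filter_not, sum_bernoulliWeight]
  have hnot : (Finset.univ : Finset (Finset κ)).filter (fun W => ¬ (∑ i ∈ W, a i ≤ t)) =
      (Finset.univ : Finset (Finset κ)).filter (fun W => t < ∑ i ∈ W, a i) := by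
    ext W; simp only [Finset.mem_filter, Finset.mem_univ, true_and, not_le]
  rw [hnot] at hsplit
  nlinarith [hsplit, h]

/-- **One fibre, top-heavy regime.**  Lower blobs `k : κ` (sizes `b k ≥ 0`, gates `u ≤ q k ≤ 1`, `0 ≤ u`), terminal `c ≥ 0`, fibre mass `s`, level `t` with
`2 (t − s) < u · (c + Σ b)` (the lower height alone has the mean for the residual level), `0 ≤ x ≤ u · w₂`:
`x · Σ_{V : s + b(V) + c ≤ t} w(V) ≤ (w₂ − x) · Σ_{V : t < s + b(V)} w(V)` (by `far_indepBlob`). [this work] -/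
theorem twoHeight_fibre_far (q b : κ → ℝ) (u : ℝ) (hu0 : 0 < u) (hu1 : u ≤ 1) (hq : ∀ k, u ≤ q k)
    (hq1 : ∀ k, q k ≤ 1) (hb : ∀ k, 0 ≤ b k) (c : ℝ) (hc : 0 ≤ c) (w₂ x : ℝ) (hx0 : 0 ≤ x) (hx : x ≤ u * w₂)
    (t s : ℝ) (hmean : 2 * (t - s) < u * (c + ∑ k, b k)) :
    x * (∑ V ∈ (Finset.univ : Finset (Finset κ)).filter (fun V => s + ∑ k ∈ V, b k + c ≤ t),
        (∏ k, if k ∈ V then q k else 1 - q k)) ≤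
      (w₂ - x) * (∑ V ∈ (Finset.univ : Finset (Finset κ)).filter (fun V => t < s + ∑ k ∈ V, b k),
        (∏ k, if k ∈ V then q k else 1 - q k)) := by
  have hu0' : 0 ≤ u := le_of_lt hu0
  have hw0 : ∀ V : Finset κ, 0 ≤ (∏ k, if k ∈ V then q k else 1 - q k) :=
    bernoulliWeight_nonneg (fun k => hu0'.trans (hq k)) hq1
  -- `far_indepBlob` for the lower height at level `t − s`, terminal `c` at gate `u`
  have hmean' : 2 * (t - s) < c * u + ∑ k, b k * q k := by
    have : u * ∑ k, b k ≤ ∑ k, b k * q k := by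
      rw [Finset.mul_sum]
      exact Finset.sum_le_sum fun k _ => by nlinarith [hq k, hb k]
    nlinarith
  have hrow := far_row q b u c hu0' hu1 hq hq1 hb hc (t - s) hmean'
  have e1 : (Finset.univ : Finset (Finset κ)).filter (fun V => s + ∑ k ∈ V, b k + c ≤ t) =
      (Finset.univ : Finset (Finset κ)).filter (fun V => ∑ k ∈ V, b k + c ≤ t - s) := by
    ext V; simp only [Finset.mem_filter, Finset.mem_univ, true_and]; constructor <;> intro h <;> linarith
  have e2 : (Finset.univ : Finset (Finset κ)).filter (fun V => t < s + ∑ k ∈ V, b k) =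
      (Finset.univ : Finset (Finset κ)).filter (fun V => t - s < ∑ k ∈ V, b k) := by
    ext V; simp only [Finset.mem_filter, Finset.mem_univ, true_and]; constructor <;> intro h <;> linarith
  rw [e1, e2]
  set L := ∑ V ∈ (Finset.univ : Finset (Finset κ)).filter (fun V => ∑ k ∈ V, b k + c ≤ t - s),
        (∏ k, if k ∈ V then q k else 1 - q k)
  set H := ∑ V ∈ (Finset.univ : Finset (Finset κ)).filter (fun V => t - s < ∑ k ∈ V, b k),
        (∏ k, if k ∈ V then q k else 1 - q k)
  have hH : 0 ≤ H := Finset.sum_nonneg fun V _ => hw0 V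
  have h1 : u * (x * L) ≤ x * ((1 - u) * H) := by nlinarith [mul_le_mul_of_nonneg_left hrow hx0]
  have h2 : x * (1 - u) ≤ u * (w₂ - x) := by nlinarith
  have h3 : x * ((1 - u) * H) ≤ u * ((w₂ - x) * H) := by nlinarith [mul_le_mul_of_nonneg_right h2 hH]
  exact le_of_mul_le_mul_left (h1.trans h3) hu0

/-- **Two-height exchange inequality, TOP-HEAVY regime (any gates).**  Upper blobs `i : ι` (sizes `a i ≥ 0`, gates `g ≤ p i ≤ 1`), lower blobs `k : κ`
(sizes `b k ≥ 0`, gates `u ≤ q k ≤ 1`), terminal `c ≥ 0`, chain data `0 ≤ x ≤ u·w₂`, `x ≤ g·w₁`, level `t`.  Let `m := t − u·(c + Σ b)/2` (fibres of upper mass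
`> m` have the lower height's mean for their residual level).  If the upper height carries the rest — `2t < g·(t − m + Σ a)`, i.e. the TOP HEIGHT PLUS THE
HALF-DISCOUNTED LOWER HEIGHT HAS THE MEAN — then
`x · Σ_U w(U) Σ_{V : a(U)+b(V)+c ≤ t} w(V) ≤ (w₁ − w₂) · Σ_{U : t < a(U)} w(U) + (w₂ − x) · Σ_U w(U) Σ_{V : t < a(U)+b(V)} w(V)`.
Proof: `far_indepBlob` fibrewise at the bottom for the good fibres, and once at the top (terminal `t − m`) for the bad ones. [this work] -/
theorem twoHeight_exchange_of_topHeavy (p a : ι → ℝ) (q b : κ → ℝ) (g u : ℝ) (hg0 : 0 < g) (hg1 : g ≤ 1)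
    (hu0 : 0 < u) (hu1 : u ≤ 1) (hp : ∀ i, g ≤ p i) (hp1 : ∀ i, p i ≤ 1) (hq : ∀ k, u ≤ q k) (hq1 : ∀ k, q k ≤ 1)
    (ha : ∀ i, 0 ≤ a i) (hb : ∀ k, 0 ≤ b k) (c : ℝ) (hc : 0 ≤ c)
    (w₁ w₂ x : ℝ) (hx0 : 0 ≤ x) (hx : x ≤ u * w₂) (hx1 : x ≤ g * w₁) (t : ℝ)
    (htop : 2 * t < g * (t - (t - u * (c + ∑ k, b k) / 2) + ∑ i, a i)) :
    x * (∑ U : Finset ι, (∏ i, if i ∈ U then p i else 1 - p i) *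
        ∑ V ∈ (Finset.univ : Finset (Finset κ)).filter (fun V => ∑ i ∈ U, a i + ∑ k ∈ V, b k + c ≤ t),
          (∏ k, if k ∈ V then q k else 1 - q k)) ≤
      (w₁ - w₂) * (∑ U ∈ (Finset.univ : Finset (Finset ι)).filter (fun U => t < ∑ i ∈ U, a i),
          (∏ i, if i ∈ U then p i else 1 - p i)) +
        (w₂ - x) * (∑ U : Finset ι, (∏ i, if i ∈ U then p i else 1 - p i) *
          ∑ V ∈ (Finset.univ : Finset (Finset κ)).filter (fun V => t < ∑ i ∈ U, a i + ∑ k ∈ V, b k),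
            (∏ k, if k ∈ V then q k else 1 - q k)) := by
  set m : ℝ := t - u * (c + ∑ k, b k) / 2 with hm
  have hg0' : 0 ≤ g := le_of_lt hg0
  have hu0' : 0 ≤ u := le_of_lt hu0
  have hmt : m ≤ t := by
    have : 0 ≤ u * (c + ∑ k, b k) := mul_nonneg hu0' (by linarith [Finset.sum_nonneg fun k (_ : k ∈ Finset.univ) => hb k])
    rw [hm]; linarith
  have hp0 : ∀ i, 0 ≤ p i := fun i => hg0'.trans (hp i)
  have hwX0 : ∀ U : Finset ι, 0 ≤ (∏ i, if i ∈ U then p i else 1 - p i) := bernoulliWeight_nonneg hp0 hp1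
  have hwY0 : ∀ V : Finset κ, 0 ≤ (∏ k, if k ∈ V then q k else 1 - q k) :=
    bernoulliWeight_nonneg (fun k => hu0'.trans (hq k)) hq1
  have hw₂x : 0 ≤ w₂ - x := by nlinarith
  -- per-fibre bound with two correction indicators
  have hfib : ∀ U : Finset ι,
      x * ((∏ i, if i ∈ U then p i else 1 - p i) *
          ∑ V ∈ (Finset.univ : Finset (Finset κ)).filter (fun V => ∑ i ∈ U, a i + ∑ k ∈ V, b k + c ≤ t),
            (∏ k, if k ∈ V then q k else 1 - q k)) ≤
        (w₂ - x) * ((∏ i, if i ∈ U then p i else 1 - p i) *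
          ∑ V ∈ (Finset.univ : Finset (Finset κ)).filter (fun V => t < ∑ i ∈ U, a i + ∑ k ∈ V, b k),
            (∏ k, if k ∈ V then q k else 1 - q k)) -
          (w₂ - x) * ((∏ i, if i ∈ U then p i else 1 - p i) * (if t < ∑ i ∈ U, a i then 1 else 0)) +
          x * ((∏ i, if i ∈ U then p i else 1 - p i) * (if ∑ i ∈ U, a i + (t - m) ≤ t then 1 else 0)) := by
    intro U
    set s := ∑ i ∈ U, a i with hs
    set wU := (∏ i, if i ∈ U then p i else 1 - p i) with hwU
    have hwU0 : 0 ≤ wU := hwX0 U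
    set L := ∑ V ∈ (Finset.univ : Finset (Finset κ)).filter (fun V => s + ∑ k ∈ V, b k + c ≤ t),
        (∏ k, if k ∈ V then q k else 1 - q k) with hL
    set H := ∑ V ∈ (Finset.univ : Finset (Finset κ)).filter (fun V => t < s + ∑ k ∈ V, b k),
        (∏ k, if k ∈ V then q k else 1 - q k) with hH
    have hH0 : 0 ≤ H := Finset.sum_nonneg fun V _ => hwY0 V
    have hL0 : 0 ≤ L := Finset.sum_nonneg fun V _ => hwY0 V
    have hL1 : L ≤ 1 := by
      calc L ≤ ∑ V : Finset κ, (∏ k, if k ∈ V then q k else 1 - q k) :=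
            Finset.sum_le_sum_of_subset_of_nonneg (Finset.subset_univ _) fun V _ _ => hwY0 V
        _ = 1 := sum_bernoulliWeight q
    by_cases hη : t < s
    · have hLz : L = 0 := by
        rw [hL]
        refine Finset.sum_eq_zero fun V hV => ?_
        rw [Finset.mem_filter] at hV
        have : 0 ≤ ∑ k ∈ V, b k := Finset.sum_nonneg fun k _ => hb k
        linarith [hV.2]
      have hnb : ¬ (s + (t - m) ≤ t) := by intro h'; linarith
      rw [if_pos hη, if_neg hnb, hLz]
      have hH1 : H = 1 := by
        have hfilt : (Finset.univ : Finset (Finset κ)).filter (fun V => t < s + ∑ k ∈ V, b k) = Finset.univ := by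
          refine Finset.filter_true_of_mem fun V _ => ?_
          have : 0 ≤ ∑ k ∈ V, b k := Finset.sum_nonneg fun k _ => hb k
          linarith
        rw [hH, hfilt]
        exact sum_bernoulliWeight q
      rw [hH1]
      nlinarith
    · rw [if_neg hη]
      by_cases hbad : s + (t - m) ≤ t
      · rw [if_pos hbad]
        have h1 : x * (wU * L) ≤ x * (wU * 1) :=
          mul_le_mul_of_nonneg_left (mul_le_mul_of_nonneg_left hL1 hwU0) hx0
        have h2 : 0 ≤ (w₂ - x) * (wU * H) := mul_nonneg hw₂x (mul_nonneg hwU0 hH0)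
        nlinarith
      · rw [if_neg hbad]
        have hgood : 2 * (t - s) < u * (c + ∑ k, b k) := by
          have : m < s := by linarith [not_le.1 hbad]
          rw [hm] at this; linarith
        have hf := twoHeight_fibre_far q b u hu0 hu1 hq hq1 hb c hc w₂ x hx0 hx t s hgood
        have := mul_le_mul_of_nonneg_left hf hwU0
        nlinarith
  have hsum := Finset.sum_le_sum fun U (_ : U ∈ (Finset.univ : Finset (Finset ι))) => hfib U
  rw [← Finset.mul_sum] at hsum
  rw [Finset.sum_add_distrib, Finset.sum_sub_distrib, ← Finset.mul_sum, ← Finset.mul_sum, ← Finset.mul_sum] at hsum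
  have hind1 : ∑ U : Finset ι, (∏ i, if i ∈ U then p i else 1 - p i) * (if t < ∑ i ∈ U, a i then (1 : ℝ) else 0) =
      ∑ U ∈ (Finset.univ : Finset (Finset ι)).filter (fun U => t < ∑ i ∈ U, a i), (∏ i, if i ∈ U then p i else 1 - p i) := by
    rw [Finset.sum_filter]
    refine Finset.sum_congr rfl fun U _ => ?_
    split_ifs <;> simp
  have hind2 : ∑ U : Finset ι, (∏ i, if i ∈ U then p i else 1 - p i) * (if ∑ i ∈ U, a i + (t - m) ≤ t then (1 : ℝ) else 0) =
      ∑ U ∈ (Finset.univ : Finset (Finset ι)).filter (fun U => ∑ i ∈ U, a i + (t - m) ≤ t),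
        (∏ i, if i ∈ U then p i else 1 - p i) := by
    rw [Finset.sum_filter]
    refine Finset.sum_congr rfl fun U _ => ?_
    split_ifs <;> simp
  rw [hind1, hind2] at hsum
  -- `far_indepBlob` for the upper height with terminal `t − m`
  have hmean : 2 * t < (t - m) * g + ∑ i, a i * p i := by
    have : g * ∑ i, a i ≤ ∑ i, a i * p i := by
      rw [Finset.mul_sum]
      exact Finset.sum_le_sum fun i _ => by nlinarith [hp i, ha i]
    nlinarith
  have hrow := far_row p a g (t - m) hg0' hg1 hp hp1 ha (by linarith) t hmean
  set Bd := ∑ U ∈ (Finset.univ : Finset (Finset ι)).filter (fun U => ∑ i ∈ U, a i + (t - m) ≤ t),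
      (∏ i, if i ∈ U then p i else 1 - p i) with hBd
  set Tp := ∑ U ∈ (Finset.univ : Finset (Finset ι)).filter (fun U => t < ∑ i ∈ U, a i),
      (∏ i, if i ∈ U then p i else 1 - p i) with hTp
  have hTp0 : 0 ≤ Tp := Finset.sum_nonneg fun U _ => hwX0 U
  have g1 : g * (x * Bd) ≤ x * ((1 - g) * Tp) := by nlinarith [mul_le_mul_of_nonneg_left hrow hx0]
  have g2 : x * (1 - g) ≤ g * (w₁ - x) := by nlinarith
  have g3 : x * ((1 - g) * Tp) ≤ g * ((w₁ - x) * Tp) := by nlinarith [mul_le_mul_of_nonneg_right g2 hTp0]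
  have g4 : x * Bd ≤ (w₁ - x) * Tp := le_of_mul_le_mul_left (g1.trans g3) hg0
  linarith

/-- **Two-height exchange inequality, BOTTOM-HEAVY regime (any gates).**  If the LOWER height alone carries the mean, `2t < u·(c + Σ_k b k)`, then every
fibre of the upper mass is paid by `far_indepBlob` at the bottom and the exchange inequality holds with no hypothesis on the upper height (the easy
'Markov' end of the two-height family, recorded for completeness of the wrapper). [this work] -/
theorem twoHeight_exchange_of_bottomHeavy (p a : ι → ℝ) (q b : κ → ℝ) (u : ℝ) (hu0 : 0 < u) (hu1 : u ≤ 1)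
    (hp0 : ∀ i, 0 ≤ p i) (hp1 : ∀ i, p i ≤ 1) (hq : ∀ k, u ≤ q k) (hq1 : ∀ k, q k ≤ 1)
    (ha : ∀ i, 0 ≤ a i) (hb : ∀ k, 0 ≤ b k) (c : ℝ) (hc : 0 ≤ c)
    (w₁ w₂ x : ℝ) (hw : w₂ ≤ w₁) (hx0 : 0 ≤ x) (hx : x ≤ u * w₂) (t : ℝ) (hbot : 2 * t < u * (c + ∑ k, b k)) :
    x * (∑ U : Finset ι, (∏ i, if i ∈ U then p i else 1 - p i) *
        ∑ V ∈ (Finset.univ : Finset (Finset κ)).filter (fun V => ∑ i ∈ U, a i + ∑ k ∈ V, b k + c ≤ t),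
          (∏ k, if k ∈ V then q k else 1 - q k)) ≤
      (w₁ - w₂) * (∑ U ∈ (Finset.univ : Finset (Finset ι)).filter (fun U => t < ∑ i ∈ U, a i),
          (∏ i, if i ∈ U then p i else 1 - p i)) +
        (w₂ - x) * (∑ U : Finset ι, (∏ i, if i ∈ U then p i else 1 - p i) *
          ∑ V ∈ (Finset.univ : Finset (Finset κ)).filter (fun V => t < ∑ i ∈ U, a i + ∑ k ∈ V, b k),
            (∏ k, if k ∈ V then q k else 1 - q k)) := by
  have hwX0 : ∀ U : Finset ι, 0 ≤ (∏ i, if i ∈ U then p i else 1 - p i) := bernoulliWeight_nonneg hp0 hp1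
  have hfib : ∀ U : Finset ι,
      x * ((∏ i, if i ∈ U then p i else 1 - p i) *
          ∑ V ∈ (Finset.univ : Finset (Finset κ)).filter (fun V => ∑ i ∈ U, a i + ∑ k ∈ V, b k + c ≤ t),
            (∏ k, if k ∈ V then q k else 1 - q k)) ≤
        (w₂ - x) * ((∏ i, if i ∈ U then p i else 1 - p i) *
          ∑ V ∈ (Finset.univ : Finset (Finset κ)).filter (fun V => t < ∑ i ∈ U, a i + ∑ k ∈ V, b k),
            (∏ k, if k ∈ V then q k else 1 - q k)) := by
    intro U
    have hs0 : 0 ≤ ∑ i ∈ U, a i := Finset.sum_nonneg fun i _ => ha i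
    have hf := twoHeight_fibre_far q b u hu0 hu1 hq hq1 hb c hc w₂ x hx0 hx t (∑ i ∈ U, a i) (by linarith)
    have := mul_le_mul_of_nonneg_left hf (hwX0 U)
    nlinarith
  have hsum := Finset.sum_le_sum fun U (_ : U ∈ (Finset.univ : Finset (Finset ι))) => hfib U
  rw [← Finset.mul_sum, ← Finset.mul_sum] at hsum
  have hextra : 0 ≤ (w₁ - w₂) * (∑ U ∈ (Finset.univ : Finset (Finset ι)).filter (fun U => t < ∑ i ∈ U, a i),
      (∏ i, if i ∈ U then p i else 1 - p i)) :=
    mul_nonneg (by linarith) (Finset.sum_nonneg fun U _ => hwX0 U)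
  linarith

end IndepBlob

end Quant

end Summit.CriticalPhenomena.PercolationContinuityZ3.Theorems
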